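import Summits.KontsevichZagierPeriods.KontsevichZagierPeriods.Theses.HermiteRigidity

/-!
# `ReducibleRigidTemplate` (stmt-KontsevichZagierPeriods-3411, route HermiteRigidity)

The algebraic template every rigid sector of the route instantiates: if every generator `s ∈ S`
of a subgroup of formal representations is congruent modulo `KZ.relations` to an element of a
subgroup `N`, and `N ∩ ker eval ≤ KZ.relations`, then `closure S ∩ ker eval ≤ KZ.relations`.

Proof: closure induction over `AddSubgroup.closure S` on the invariant
`∃ x ∈ N, c - x ∈ KZ.relations` (the set of such `c` is a subgroup containing `S`); then the
soundness of the calculus (`KZ.relations_le_ker_eval_holds`, relations evaluate to `0`) turns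
`eval c = 0` into `eval x = 0`, the hypothesis on `N` gives `x ∈ KZ.relations`, and
`c = (c - x) + x`. [Kontsevich–Zagier 2001, §1.2]
-/

namespace Summit.KontsevichZagierPeriods.HermiteRigidity.ReducibleRigidTemplate

open Literature.NumberTheory.Transcendental

/-- Closure induction step of the template: if every generator `s ∈ S` is congruent modulo
`KZ.relations` to an element of the subgroup `N`, then so is every element of
`AddSubgroup.closure S`. [Kontsevich–Zagier 2001, §1.2] -/
theorem exists_mem_sub_mem_relations_of_mem_closure
    {S : Set KZ.FormalRep} {N : AddSubgroup KZ.FormalRep}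
    (hS : ∀ s ∈ S, ∃ x ∈ N, s - x ∈ KZ.relations)
    {c : KZ.FormalRep} (hc : c ∈ AddSubgroup.closure S) :
    ∃ x ∈ N, c - x ∈ KZ.relations := by
  induction hc using AddSubgroup.closure_induction with
  | mem s hs => exact hS s hs
  | zero => exact ⟨0, N.zero_mem, by rw [sub_zero]; exact KZ.relations.zero_mem⟩
  | add a b _ _ iha ihb =>
    obtain ⟨x, hx, hax⟩ := iha
    obtain ⟨y, hy, hby⟩ := ihb
    refine ⟨x + y, N.add_mem hx hy, ?_⟩
    have : a + b - (x + y) = (a - x) + (b - y) := by abel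
    rw [this]
    exact KZ.relations.add_mem hax hby
  | neg a _ iha =>
    obtain ⟨x, hx, hax⟩ := iha
    refine ⟨-x, N.neg_mem hx, ?_⟩
    have : -a - -x = -(a - x) := by abel
    rw [this]
    exact KZ.relations.neg_mem hax

/-- **`ReducibleRigidTemplate`** (item stmt-KontsevichZagierPeriods-3411): if every generator
`s ∈ S` is congruent modulo `KZ.relations` to an element of a subgroup `N`, and every element of
`N` with value `0` is a relation, then every element of `AddSubgroup.closure S` with value `0` is a
relation. Closure induction (`exists_mem_sub_mem_relations_of_mem_closure`) plus soundness of the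
calculus (`KZ.relations_le_ker_eval_holds`). [Kontsevich–Zagier 2001, §1.2] -/
theorem ReducibleRigidTemplate_proof :
    Summit.KontsevichZagierPeriods.KontsevichZagierPeriods.Theses.HermiteRigidity.ReducibleRigidTemplate := by
  unfold Summit.KontsevichZagierPeriods.KontsevichZagierPeriods.Theses.HermiteRigidity.ReducibleRigidTemplate
  intro S N hS hN c hc hc0
  obtain ⟨x, hx, hcx⟩ := exists_mem_sub_mem_relations_of_mem_closure hS hc
  have hx0 : KZ.eval x = 0 := by
    have h := (AddMonoidHom.mem_ker).1 (KZ.relations_le_ker_eval_holds hcx)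
    rw [map_sub, hc0, zero_sub, neg_eq_zero] at h
    exact h
  have hxr : x ∈ KZ.relations := hN x hx hx0
  have : c = (c - x) + x := by abel
  rw [this]
  exact KZ.relations.add_mem hcx hxr

end Summit.KontsevichZagierPeriods.HermiteRigidity.ReducibleRigidTemplate
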